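import Literature.Probability.Percolation.QuadCrossingContinuityFourMoves
import Literature.Probability.Percolation.QuadChartCrossedOfCrossing
import Literature.Probability.Percolation.QuadCrossingOfChartCrossed
import Literature.Probability.Percolation.QuadLeftMoveBound
import Literature.Probability.Percolation.QuadBottomMoveBound
import HarnessLib

/-!
# Schramm–Smirnov's Lemma 5.1 for bond-`ℤ²`: the discharge

Topic `Probability/Percolation`; proofs only.  DISCHARGE of the named fact
`QuadCrossing.SchrammSmirnov2011_lemma_5_1` (`QuadCrossingContinuityEvents.lean`): O. Schramm,
S. Smirnov, *On the scaling limits of planar percolation*, Ann. Probab. 39 (2011) 1768–1814,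
arXiv:1101.5820, **Lemma 5.1** — "Let `μ₀` be some subsequential scaling limit, then the boundary
(in topology `𝒯` on `ℋ`) of a crossing event has probability zero.  Namely, `μ₀(∂⊞_{Q₀}) = 0`
holds for every `Q₀ ∈ 𝒬_D`" — in the tree's rendering for critical bond percolation on `δℤ²`
(`IsSubseqQuadLimit`, every open nonempty `D ⊆ ℂ`, every quad).

The proof is the four-move assembly `schrammSmirnov2011_lemma_5_1_of_chartMoves`
(`QuadCrossingContinuityFourMoves.lean`: §5 of the source over a homeomorphic chart of `Q₀`,
`Q' = H∘rect(1-s,1+s) < Q₀ < Q'' = H∘rect(1+s,1-s)`, four one-sided moves of Lemma 6.1 with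
constants, union bound, `SchrammSmirnov2011_lemma_5_1_of_continuity`) instantiated at the four
chart lemmas `SSContinuity.chartCrossed_of_isCrossing_rectQuad` (`QuadChartCrossedOfCrossing.lean`),
`SSContinuity.isCrossing_rectQuad_of_chartCrossed` (`QuadCrossingOfChartCrossed.lean`),
`SSContinuity.exists_leftMove_bound` (`QuadLeftMoveBound.lean`) and
`SSContinuity.exists_bottomMove_bound` (`QuadBottomMoveBound.lean`), themselves resting on the
lowest-crossing proof of Lemma 6.1 (2)/(3) for charted rectangles
(`SSContinuity.exists_move_bound`, `SSContinuity.exists_topMove_bound`,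
`QuadLowestCrossingProofs.lean`: RSW for bond-`ℤ²` at `1/2`, duality, the explored region).
No hypothesis remains: the trust base of `SchrammSmirnov2011_lemma_5_1_holds` is the kernel.

Consequences already in the tree that hereby become unconditional in this input: the Boolean
algebra of finitely many crossing events consists of continuity sets of every subsequential limit
(`SchrammSmirnov2011_lemma_5_1.measure_frontier_dnf_eq_zero`, Cor. 5.2's hypothesis), the
discrete continuity estimate (5.1) (`Quad.continuity_of_lemma_5_1`), and the users in
`QuadCrossingRotationInvarianceOfThm21.lean`, `QuadCrossingRotationUniformity.lean`,
`QuadCrossingNoiseSplit.lean` (Thm. 1.7 / Cor. 1.8 modulo Prop. 4.1).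

## References

* O. Schramm, S. Smirnov, Ann. Probab. 39 (2011) 1768–1814, arXiv:1101.5820: Lemma 5.1 (§5,
  p. 21), Lemma 6.1 (§6). [SchrammSmirnov2011]
-/

noncomputable section

namespace Literature.Probability.Percolation

namespace QuadCrossing

/-- **Schramm–Smirnov 2011, Lemma 5.1, for critical bond percolation on `δℤ²` — DISCHARGED.**
For every open nonempty `D ⊆ ℂ`, every subsequential scaling limit `μ` of the laws of critical
bond percolation on `δℤ²` in the Schramm–Smirnov space `ℋ_D` and every quad `Q ∈ 𝒬_D`, the
topological boundary of the crossing event `⊞_Q` is `μ`-null: `μ (frontier ⊞_Q) = 0`.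
(Four-move assembly over the charted-rectangle form of Lemma 6.1; see the module docstring.)
[cite: SchrammSmirnov2011, Lemma 5.1] -/
theorem SchrammSmirnov2011_lemma_5_1_holds : SchrammSmirnov2011_lemma_5_1 :=
  schrammSmirnov2011_lemma_5_1_of_chartMoves
    (fun H a b ha hb hD δ ω K hK hKω =>
      SSContinuity.chartCrossed_of_isCrossing_rectQuad H a b ha hb hD δ ω K hK hKω)
    (fun H a b ha hb hD c d δ ω hc hd h =>
      SSContinuity.isCrossing_rectQuad_of_chartCrossed H a b ha hb hD c d δ ω hc hd h)
    (fun H _ hε => SSContinuity.exists_leftMove_bound H hε)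
    (fun H _ hε => SSContinuity.exists_bottomMove_bound H hε)

end QuadCrossing

end Literature.Probability.Percolation

end
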